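import Mathlib
import HarnessLib
import Summits.HubbardSuperconductivity.HubbardSuperconductivity.Theorems.KLProgrammeKLRegimeSplitBundleV8
import Summits.HubbardSuperconductivity.HubbardSuperconductivity.Theorems.KLProgrammeKLRegimeSplitTwoLegAngular

/-!
# Route `KLProgramme` — crux K3 `KLRegimeTwoPointLimit` (stmt-HubbardSuperconductivity-19937): the bundle
# `klPredsV9 := { klPredsV8 with twoLeg := TwoLegStepV9 }` — V8 (Δ16 count repair) with the two-leg slot extended by the ANGULAR-REGULARITY
# conjunct (E3g) `TwoLegAngularG` (defect Δ18, seat hubbard-kl-k3c3-p3; plan g10 ruling 2026-08-26T17:26:06Z «HOLD gen 3 FOR Δ18»; typist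
# hubbard-kl-k3c2-p3)

Δ18 (k3c3-p3, HOME/STATUS 17:08Z; HOME/hubbard-kl-k3c3-p3/DEFECT-ANGULAR.md; texts `…SplitTwoLegAngular`, p458559).  `RenormalisedAtF … n` and child 2's
`CtOneVolume` bound the local part `θ ↦ ν_n(K)(θ) = klLocalPart … n θ` at EVERY real angle, while every V6/V7/V8 two-leg clause reads it only at
the lattice angles `momentumAngle L k` and through its angular mean (`klFrameExtG_congr`), at shell lattice angles (`TwoLegSlopes`) or through
volume differences (`TwoLegVolumeRate`); between lattice angles nothing was asserted, so the renormalisation antecedents were not certifiable by a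
child-2 prover (the Δ14 class: volume ↦ angle).  REPAIR (R-ang, g10 (2), p1's l.955 amendment as typed by k3c3-p3): ONE more ENGINE-OUTPUT
conjunct in the two-leg slot, (E3g) `TwoLegAngularG L M G Q R β U μ K n` — `θ ↦ ν_n(K)(θ)` is `C⁴` with `|∂_θ^j ν_n| ≤ angBar G Q R U (nScales β) j`,
`1 ≤ j ≤ 4`, volume-uniform (not scale-free).

THE BUNDLE (g10 (3), names prescribed): the engine / split / renorm / frame slots and the history are V8's VERBATIM (`EngineBoundsAtV6S`,
`BetaSplitAtS2`, `RenormalisedAtF`, `FrameOK`, `histV8`; `histV9` is provided as an ALIAS of `histV8` — the history carries no two-leg slot);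
`TwoLegStepV9 := TwoLegStepG histV8 ∧ TwoLegAngularG ∧ TwoLegVolumeRate (histV8 ∧ TwoLegStepG histV8 ∧ TwoLegAngularG)` (the (E3f) comparison-volume
antecedent gains the conjunct too, k3c3-p3 l.939); `klPredsV9 := { klPredsV8 with twoLeg := TwoLegStepV9 }`; slot `rfl` lemmas (`_frameOK/_renorm/
_split/_engine` = V8's, `_twoLeg`); `twoLegStepG_of_twoLegStepV9`, `twoLegAngularG_of_twoLegStepV9`, `twoLegStepGA_of_twoLegStepV9` (k3c3-p3's packaging
`TwoLegStepGA hist := TwoLegStepG hist ∧ TwoLegAngularG`), `histV8_of_histP_V9`, `histRateV9_of_histP`; the scale-0 note: the engine slot is V8's, so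
`engineBoundsAtV6S_zero_iff` (BundleV8 §4) serves unchanged.  Children of gen 3 (g10 (3)): `KLRegime{Engine,BetaSplit,Counterterm,VolumeLimit,
TwoPointAssembly}V9` = `EngineP4 | BetaSplitP | CountertermP2 | VolumeLimitP2 (FinalTwoLegVolLimit) | TwoPointAssemblyP3 (FinalTwoLegVolLimit)` on
`klPredsV9 klWindowC`; glue closer `KLRegimeInductionV9P4` (`…SplitGlueV9P4`).  Definitions (+ `rfl`-level bookkeeping) only; nothing is asserted
about the model.
-/

noncomputable section

namespace Summit.HubbardSuperconductivity.HubbardSuperconductivity.Theorems.KLRegimeSplit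

set_option linter.dupNamespace false -- summit = problem name (single-conjunct summit), D-0017

open Real Finset Literature.MathematicalPhysics.QuantumLattice Literature.Probability.LatticeModels
open Summit.HubbardSuperconductivity.HubbardSuperconductivity.Theorems.KLProgrammeLegKernels

section Model

variable (L M : ℕ) [NeZero L] [NeZero M]

/-- **The comparison-frame / comparison-volume history of the V9 bundle** — an ALIAS of `histV8` (`BetaSplitAtS2 ∧ RenormalisedAtF ∧
EngineBoundsAtV6S`): the history carries no two-leg slot, so Δ18 does not touch it.  All V9 texts below are stated with `histV8` itself. -/
abbrev histV9 (G : GeoConsts) (P : SplitConsts) (Q : EngConsts) (R : RenConsts) (β U μ : ℝ) : TrigPolyC4v → ℕ → Prop :=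
  histV8 L M G P Q R β U μ

/-- **`TwoLegStepV9 … G P Q R K n`** := `TwoLegStepG histV8 ∧ TwoLegAngularG ∧ TwoLegVolumeRate (histV8 ∧ TwoLegStepG histV8 ∧ TwoLegAngularG)` —
V8's two-leg slot with the angular-regularity conjunct (E3g) added, both AT the slot's volume and in the (E3f) comparison-volume antecedent (the
full non-self history there).  Same slot type as `Preds.twoLeg`. -/
def TwoLegStepV9 (G : GeoConsts) (P : SplitConsts) (Q : EngConsts) (R : RenConsts) (β U μ : ℝ) (K : TrigPolyC4v) (n : ℕ) :
    Prop :=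
  TwoLegStepG L M (histV8 L M G P Q R β U μ) G P Q R β U μ K n ∧ TwoLegAngularG L M G Q R β U μ K n ∧
    TwoLegVolumeRate L M
      (fun L' M' _ _ K' j => histV8 L' M' G P Q R β U μ K' j ∧
        TwoLegStepG L' M' (histV8 L' M' G P Q R β U μ) G P Q R β U μ K' j ∧ TwoLegAngularG L' M' G Q R β U μ K' j)
      Q β U μ K n

end Model

/-- **`klPredsV9 : Preds`** := `{ klPredsV8 with twoLeg := TwoLegStepV9 }` = `{ frameOK := FrameOK, renorm := RenormalisedAtF,
split := BetaSplitAtS2, engine := EngineBoundsAtV6S, twoLeg := TwoLegStepV9 }`.  Children of gen 3: `EngineP4 klPredsV9 klWindowC`,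
`BetaSplitP klPredsV9 klWindowC`, `CountertermP2 klPredsV9 klWindowC`, `VolumeLimitP2 klPredsV9 FinalTwoLegVolLimit klWindowC`,
`TwoPointAssemblyP3 klPredsV9 FinalTwoLegVolLimit klWindowC`. -/
def klPredsV9 : Preds :=
  { klPredsV8 with twoLeg := fun L M _ _ G P Q R β U μ K n => TwoLegStepV9 L M G P Q R β U μ K n }

/-! ## Bookkeeping (`rfl`-level) -/

/-- V9's frame class IS V8's (`FrameOK`). -/
theorem klPredsV9_frameOK : klPredsV9.frameOK = klPredsV8.frameOK := rfl

/-- V9's renormalisation slot IS V8's (`RenormalisedAtF`). -/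
theorem klPredsV9_renorm : klPredsV9.renorm = klPredsV8.renorm := rfl

/-- V9's split slot IS V8's (`BetaSplitAtS2`). -/
theorem klPredsV9_split : klPredsV9.split = klPredsV8.split := rfl

/-- V9's engine slot IS V8's (`EngineBoundsAtV6S`; so BundleV8's `engineBoundsAtV6S_zero_iff` serves the scale-0 rung unchanged). -/
theorem klPredsV9_engine : klPredsV9.engine = klPredsV8.engine := rfl

/-- V9's engine slot is `EngineBoundsAtV6S`. -/
theorem klPredsV9_engine_apply (L M : ℕ) [NeZero L] [NeZero M] (G : GeoConsts) (P : SplitConsts) (Q : EngConsts) (β U μ : ℝ)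
    (K : TrigPolyC4v) (n : ℕ) : klPredsV9.engine L M G P Q β U μ K n = EngineBoundsAtV6S L M G P Q β U μ K n := rfl

/-- V9's split slot is `BetaSplitAtS2`. -/
theorem klPredsV9_split_apply (L M : ℕ) [NeZero L] [NeZero M] (G : GeoConsts) (P : SplitConsts) (Q : EngConsts) (β U μ : ℝ)
    (K : TrigPolyC4v) (n : ℕ) : klPredsV9.split L M G P Q β U μ K n = BetaSplitAtS2 L M G P Q β U μ K n := rfl

/-- V9's two-leg slot is `TwoLegStepV9`. -/
theorem klPredsV9_twoLeg (L M : ℕ) [NeZero L] [NeZero M] (G : GeoConsts) (P : SplitConsts) (Q : EngConsts) (R : RenConsts)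
    (β U μ : ℝ) (K : TrigPolyC4v) (n : ℕ) :
    klPredsV9.twoLeg L M G P Q R β U μ K n = TwoLegStepV9 L M G P Q R β U μ K n := rfl

/-- The history alias unfolds to `histV8`. -/
theorem histV9_eq (L M : ℕ) [NeZero L] [NeZero M] (G : GeoConsts) (P : SplitConsts) (Q : EngConsts) (R : RenConsts) (β U μ : ℝ) :
    histV9 L M G P Q R β U μ = histV8 L M G P Q R β U μ := rfl

section Model

variable {L M : ℕ} [NeZero L] [NeZero M] {G : GeoConsts} {P : SplitConsts} {Q : EngConsts} {R : RenConsts} {β U μ : ℝ}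
  {K : TrigPolyC4v} {n : ℕ}

/-- The «G» two-leg step is the first conjunct of the V9 two-leg slot. -/
theorem twoLegStepG_of_twoLegStepV9 (h : TwoLegStepV9 L M G P Q R β U μ K n) :
    TwoLegStepG L M (histV8 L M G P Q R β U μ) G P Q R β U μ K n := h.1

/-- (E3g) is the second conjunct of the V9 two-leg slot. -/
theorem twoLegAngularG_of_twoLegStepV9 (h : TwoLegStepV9 L M G P Q R β U μ K n) :
    TwoLegAngularG L M G Q R β U μ K n := h.2.1

/-- k3c3-p3's packaging: the V9 two-leg slot yields `TwoLegStepGA histV8` (= `TwoLegStepG histV8 ∧ TwoLegAngularG`). -/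
theorem twoLegStepGA_of_twoLegStepV9 (h : TwoLegStepV9 L M G P Q R β U μ K n) :
    TwoLegStepGA L M (histV8 L M G P Q R β U μ) G P Q R β U μ K n := ⟨h.1, h.2.1⟩

/-- The volume-rate conjunct (E3f) of the V9 two-leg slot, with its V9 antecedent. -/
theorem twoLegVolumeRate_of_twoLegStepV9 (h : TwoLegStepV9 L M G P Q R β U μ K n) :
    TwoLegVolumeRate L M
      (fun L' M' _ _ K' j => histV8 L' M' G P Q R β U μ K' j ∧
        TwoLegStepG L' M' (histV8 L' M' G P Q R β U μ) G P Q R β U μ K' j ∧ TwoLegAngularG L' M' G Q R β U μ K' j)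
      Q β U μ K n := h.2.2

/-- `HistP klPredsV9` below `n` yields the V8 (= V9) history: `histV8 … K j` for every `j < n`. -/
theorem histV8_of_histP_V9 (h : HistP klPredsV9 L M G P Q R β U μ K n) : ∀ j < n, histV8 L M G P Q R β U μ K j :=
  fun j hj => ⟨(h j hj).1, (h j hj).2.1, (h j hj).2.2.1⟩

/-- `HistP klPredsV9` below `n` yields the full (E3f) antecedent of V9 at that volume: `histV8 ∧ TwoLegStepG histV8 ∧ TwoLegAngularG` at every `j < n`. -/
theorem histRateV9_of_histP (h : HistP klPredsV9 L M G P Q R β U μ K n) :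
    ∀ j < n, histV8 L M G P Q R β U μ K j ∧ TwoLegStepG L M (histV8 L M G P Q R β U μ) G P Q R β U μ K j ∧
      TwoLegAngularG L M G Q R β U μ K j := fun j hj =>
  ⟨⟨(h j hj).1, (h j hj).2.1, (h j hj).2.2.1⟩, (h j hj).2.2.2.1, (h j hj).2.2.2.2.1⟩

/-- Dropping (E3g): a V9 two-leg step whose volume-rate antecedent is met V8-style is NOT implied (the V9 rate clause assumes more at the
comparison volume); what IS implied is the V8 slot's first conjunct and, given the angular clause at the comparison volumes, its rate clause:
`TwoLegStepV9 → (∀ L' M' K' j, … → TwoLegAngularG L' M' … K' j available) → TwoLegStepV8`.  Stated in the usable direction: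
**V9's rate clause applies whenever the comparison volume carries the V9 history** — a restatement of `twoLegVolumeRate_of_twoLegStepV9` for
consumers holding `HistP klPredsV9` at `(L', M')` (`histRateV9_of_histP`). -/
theorem twoLegVolumeRate_apply_of_V9 (h : TwoLegStepV9 L M G P Q R β U μ K n) (hM : Q.M0 β L ≤ M) {L' M' : ℕ} [NeZero L'] [NeZero M']
    (hL : L ≤ L') (hM' : Q.M0 β L' ≤ M') (hhist : HistP klPredsV9 L' M' G P Q R β U μ K n) (θ : ℝ) :
    |klLocalPart L M β U μ K n θ - klLocalPart L' M' β U μ K n θ| ≤ Q.CL β n / L :=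
  h.2.2 hM L' M' hL hM' (histRateV9_of_histP hhist) θ

end Model

end Summit.HubbardSuperconductivity.HubbardSuperconductivity.Theorems.KLRegimeSplit

end
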